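import Mathlib
import Literature.Analysis.UnboundedOperators.HeatExtensionHarnack
import Summits.NavierStokesRegularity.NavierStokesRegularity.Theorems.LevelSetModerationHighSpeedPressureWorkFastSetSource
import Summits.NavierStokesRegularity.NavierStokesRegularity.Theorems.LevelSetModerationHighSpeedPressureWorkFastSetElementary

/-!
# Route LevelSetModeration — `HighSpeedPressureWork`: the caloric deficit at a fast point (log-free form)

Support file for item stmt-NavierStokesRegularity-18149 (`HighSpeedPressureWork`), stub
`stub_earlyBookkeeping` (margin zero): the analytic heart of the LOG-FREE fast-set speed-gradient
bound (`…FastSetGradientLogFreeUnit.lean`). In the unit normalisation (`ν = 1`, speed `≤ 1` on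
`(0, T]`), at a time `t ≤ ε` and a point `x` that is fast in a unit direction `e`
(`⟪e, u(t,x)⟫ > 1/2`), with `B_s` any bound of `‖u(t²,·)‖` in `[1/2, 1]` within `C t` of `1/2`
(the overshoot at the early time `s₀ = t²`), the caloric deficit

  `δ = e^{(t−s₀)Δ}(B_s − ⟪e, u(s₀)⟫)(x)`

admits a majorant `V₀ ∈ [δ, 2B_s]`, `V₀ > 0`, with `V₀ √(1 + log(2B_s/V₀)) ≤ (a₀ + a₁ C) √t`
(`levelSetModeration_fastSet_deficit_le`) — exactly the input of Hamilton's logarithmic gradient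
estimate that makes `∇e^{(t−s₀)Δ}(B_s − ⟪e,u(s₀)⟫)(x)` BOUNDED (no `√log(1/t)`).

Proof (the new mechanism). Fastness gives `δ ≤ C t + ‖B_{s₀}(u,u)(t,x)‖`. Each slice of the
Duhamel term at `x` is bounded by `levelSetModeration_oseenSlice_source_le` with the radius
`r(σ) = √((t−σ)ℓ)`, `ℓ = log(1/(2δ))`: inside, the sharp Harnack inequality
(`heatExtension_le_harnack_shift`) gives `e^{(σ−s₀)Δ}(B_s − ⟪e,u(s₀)⟫) ≤ ((t−s₀)/(σ−s₀))^{3/2} e^{ℓ/4} δ`,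
so the sources `u − B_s e` are `≲ (2δ)^{3/8}` there; outside, the far field is `≲ 1/r(σ)`. The time
integral (`fastSet_integral_sourceBound_le`) is `24C_S(2δ)^{3/8}√t + 8C_S C_D t + 8C_F √t/√ℓ`, whence
either `δ ≤ t²` (take `V₀ = t²`) or `δ √ℓ ≤ a √t` (take `V₀ = δ`).
-/

noncomputable section

-- single-conjunct summit: `Summit.<Summit>.<Problem>` repeats the name by the D-0017 layout
set_option linter.dupNamespace false

namespace Summit.NavierStokesRegularity.NavierStokesRegularity.Theorems

open MeasureTheory Set Filter Topology Function Metric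
open scoped ENNReal RealInnerProductSpace
open Literature.Analysis.FluidPDE
open Literature.Analysis.UnboundedOperators (heatExtension heatKernel heatExtension_apply
  norm_heatExtension_le_of_bound heatExtension_le_harnack_shift contDiff_heatExtension_holds
  memLp_top_of_continuous_of_bound)

/-- **The caloric deficit at a fast point, log-free form.** See the file header: absolute
constants `a₀, a₁ ≥ 0`, `ε > 0` such that for every classical solution (`ν = 1`) on
`ℝ³ × (0, b)` with `‖u‖ ≤ 1` on `(0, T] × ℝ³` (`T < b`), `‖u(t)‖_{L²} ≤ K < ∞` there, every
`t ∈ (0, T)` with `t ≤ ε`, constants `C ≥ 0` with `C t ≤ 1/8` and `B_s ∈ [1/2, 1]` with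
`B_s − 1/2 ≤ C t` and `‖u(t², ·)‖ ≤ B_s`, every point `x` and unit vector `e` with
`⟪e, u(t,x)⟫ > 1/2`, there is `V₀` with `e^{(t−t²)Δ}(B_s − ⟪e, u(t²)⟫)(x) ≤ V₀`, `0 < V₀ ≤ 2B_s`
and `V₀ √(1 + log(2B_s/V₀)) ≤ (a₀ + a₁ C) √t`. [folklore] -/
theorem levelSetModeration_fastSet_deficit_le :
    ∃ a₀ a₁ ε : ℝ, 0 ≤ a₀ ∧ 0 ≤ a₁ ∧ 0 < ε ∧ ∀ {b T : ℝ} {u : ℝ → EuclideanSpace ℝ (Fin 3) → EuclideanSpace ℝ (Fin 3)} {p : ℝ → EuclideanSpace ℝ (Fin 3) → ℝ}, Literature.Analysis.FluidPDE.IsClassicalNSSolutionOn (Set.Ioo 0 b) 1 0 u p → 0 < T → T < b → (∀ t ∈ Set.Ioc 0 T, ∀ x, ‖u t x‖ ≤ 1) → ∀ {K : ENNReal}, K ≠ ⊤ → (∀ t ∈ Set.Ioc 0 T, MeasureTheory.eLpNorm (u t) 2 MeasureTheory.volume ≤ K) → ∀ t ∈ Set.Ioo 0 T, t ≤ ε →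 ∀ (Cov Bs : ℝ), 0 ≤ Cov → Cov * t ≤ 1 / 8 → 1 / 2 ≤ Bs → Bs ≤ 1 → Bs - 1 / 2 ≤ Cov * t → (∀ y, ‖u (t ^ 2) y‖ ≤ Bs) → ∀ (x e : EuclideanSpace ℝ (Fin 3)), ‖e‖ = 1 → 1 / 2 < inner ℝ e (u t x) → ∃ V₀ : ℝ, Literature.Analysis.UnboundedOperators.heatExtension (fun y => Bs - inner ℝ e (u (t ^ 2) y)) (t - t ^ 2) x ≤ V₀ ∧ 0 < V₀ ∧ V₀ ≤ 2 * Bs ∧ V₀ * Real.sqrt (1 + Real.log (2 * Bs / V₀)) ≤ (a₀ + a₁ * Cov) * Real.sqrt t := by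
  obtain ⟨CD, hCD, hDuh⟩ := exists_norm_oseenDuhamel_le_mul (E := EuclideanSpace ℝ (Fin 3))
  obtain ⟨CS, CF, hCS, hCF, hSrc⟩ := levelSetModeration_oseenSlice_source_le
  set a₀ : ℝ := 4 * CD + Real.sqrt 2 * (8 * CS * CD) + 48 * CS + 8 * CF + 3 with ha₀_def
  set a₁ : ℝ := 2 + Real.sqrt 2 with ha₁_def
  set ε : ℝ := min (1 / 2) (1 / (256 * CD ^ 2)) with hε_def
  have hε0 : 0 < ε := by rw [hε_def]; positivity
  refine ⟨a₀, a₁, ε, by positivity, by positivity, hε0, ?_⟩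
  intro b T u p hcl' hT hTb hbd' K hK hL2' t ht htε Cov Bs hCov hCovt hBs12 hBs1 hBsC hus₀' x e hen hex
  have ht0 : 0 < t := ht.1
  -- the constants of the two regimes
  set a : ℝ := Real.sqrt 2 * (Cov + 8 * CS * CD) + 48 * CS + 8 * CF with ha_def
  have ha0 : 0 ≤ a := by rw [ha_def]; positivity
  set a' : ℝ := 2 * Cov + 4 * CD + a + 3 with ha'_def
  have ha'0 : 0 ≤ a' := by rw [ha'_def]; positivity
  have ha'eq : a' = a₀ + a₁ * Cov := by rw [ha'_def, ha_def, ha₀_def, ha₁_def]; ring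
  -- the window
  have ht12 : t ≤ 1 / 2 := htε.trans (min_le_left _ _)
  have ht1 : t ≤ 1 := by linarith
  have htCD : 2 * CD * Real.sqrt t ≤ 1 / 8 := by
    have h1 : t ≤ 1 / (256 * CD ^ 2) := htε.trans (min_le_right _ _)
    have h2 : Real.sqrt t ≤ Real.sqrt (1 / (256 * CD ^ 2)) := Real.sqrt_le_sqrt h1
    have h3 : Real.sqrt (1 / (256 * CD ^ 2)) = 1 / (16 * CD) := by
      rw [show (1 : ℝ) / (256 * CD ^ 2) = (1 / (16 * CD)) ^ 2 by field_simp; norm_num,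
        Real.sqrt_sq (by positivity)]
    rw [h3] at h2
    calc 2 * CD * Real.sqrt t ≤ 2 * CD * (1 / (16 * CD)) := mul_le_mul_of_nonneg_left h2 (by positivity)
      _ = 1 / 8 := by field_simp; norm_num
  -- times: `s₀ = t²`
  set s₀ : ℝ := t ^ 2 with hs₀_def
  have hs₀ : 0 < s₀ := by rw [hs₀_def]; exact pow_pos ht0 2
  have hs₀t : s₀ < t := by rw [hs₀_def, sq]; exact mul_lt_of_lt_one_left ht0 (by linarith)
  have hs₀T : s₀ < T := hs₀t.trans ht.2
  have hts : t / 2 ≤ t - s₀ := by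
    have : t ^ 2 ≤ t * (1 / 2) := by rw [sq]; exact mul_le_mul_of_nonneg_left ht12 ht0.le
    rw [hs₀_def]; linarith
  have hts0 : 0 < t - s₀ := sub_pos.2 hs₀t
  have hsqt : 0 < Real.sqrt t := Real.sqrt_pos.2 ht0
  have hBs0 : 0 < Bs := by linarith
  have hus₀ : ∀ y, ‖u s₀ y‖ ≤ Bs := hus₀'
  -- (1) the mild formula from `s₀`
  have hmild : ∀ {σ : ℝ}, s₀ < σ → σ < T → ∀ y,
      u σ y = heatExtension (u s₀) (σ - s₀) y - oseenDuhamel 1 s₀ u u σ y := fun hσ hσT y =>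
    mild_of_bounded_of_eLpNorm_two_le_of_lt hcl' hT hTb hbd' hK hL2' hs₀ hσ hσT y
  have hbd : ∀ τ, s₀ < τ → τ ≤ t → ∀ y, ‖u τ y‖ ≤ 1 := fun τ h1 h2 y =>
    hbd' τ ⟨hs₀.trans h1, h2.trans ht.2.le⟩ y
  -- (3) the Duhamel sup bound from `s₀`
  have hduh : ∀ {σ : ℝ}, s₀ < σ → σ ≤ t → ∀ y, ‖oseenDuhamel 1 s₀ u u σ y‖ ≤ 2 * CD * Real.sqrt t := by
    intro σ hσ hσt y
    have hbdI : ∀ τ ∈ Ioo s₀ σ, ∀ y, ‖u τ y‖ ≤ 1 := fun τ hτ y =>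
      hbd τ hτ.1 (hτ.2.le.trans hσt) y
    have h := hDuh one_pos hσ zero_le_one zero_le_one hbdI hbdI y
    rw [Real.one_rpow] at h
    have h2 : Real.sqrt (σ - s₀) ≤ Real.sqrt t := Real.sqrt_le_sqrt (by linarith [hs₀.le])
    calc ‖oseenDuhamel 1 s₀ u u σ y‖ ≤ CD * 1 * 1 * 1 * (2 * Real.sqrt (σ - s₀)) := h
      _ ≤ CD * 1 * 1 * 1 * (2 * Real.sqrt t) := by gcongr
      _ = 2 * CD * Real.sqrt t := by ring
  -- (5) the datum `g = Bs − ⟪e, u(s₀)⟫ ∈ [0, 2Bs]` and the deficit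
  set g : EuclideanSpace ℝ (Fin 3) → ℝ := fun y => Bs - ⟪e, u s₀ y⟫ with hg
  have hcont_s₀ : Continuous (u s₀) := (hcl'.contDiff_velocity ⟨hs₀, hs₀T.trans hTb⟩).continuous
  have hgc : Continuous g := continuous_const.sub (continuous_const.inner hcont_s₀)
  have hinner_le : ∀ y, |⟪e, u s₀ y⟫| ≤ Bs := fun y =>
    (abs_real_inner_le_norm e (u s₀ y)).trans (by rw [hen, one_mul]; exact hus₀ y)
  have hg0 : ∀ y, 0 ≤ g y := fun y => by
    have := (le_abs_self _).trans (hinner_le y)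
    simp only [hg]; linarith
  have hgM : ∀ y, g y ≤ 2 * Bs := fun y => by
    have h2 : -Bs ≤ ⟪e, u s₀ y⟫ := (neg_le_neg (hinner_le y)).trans (neg_abs_le _)
    simp only [hg]; linarith
  have hgb : ∀ y, ‖g y‖ ≤ 2 * Bs := fun y => by
    rw [Real.norm_of_nonneg (hg0 y)]; exact hgM y
  set δ : ℝ := heatExtension g (t - s₀) x with hδ
  have hδ0 : 0 ≤ δ := fastSet_heatExtension_nonneg hg0 hts0 x
  have hδM : δ ≤ 2 * Bs := by
    have := norm_heatExtension_le_of_bound hgb hts0 x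
    rw [Real.norm_of_nonneg hδ0] at this
    exact this
  -- (6) the caloric part at time `t` and the fastness inequality `δ ≤ C t + ‖w(x)‖`
  set Ht : EuclideanSpace ℝ (Fin 3) → EuclideanSpace ℝ (Fin 3) := heatExtension (u s₀) (t - s₀) with hHt
  set wt : EuclideanSpace ℝ (Fin 3) → EuclideanSpace ℝ (Fin 3) := fun y => oseenDuhamel 1 s₀ u u t y
    with hwt
  have hgHt : heatExtension g (t - s₀) = fun z => Bs - ⟪e, Ht z⟫ := by
    funext z; rw [hHt]; exact heatExtension_const_sub_inner hcont_s₀ hus₀ Bs e hts0 z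
  have hwt_le : ‖wt x‖ ≤ 2 * CD * Real.sqrt t := hduh hs₀t le_rfl x
  have hδle : δ ≤ Cov * t + ‖wt x‖ := by
    have hHx : Ht x = u t x + wt x := by
      rw [hHt, hwt]; dsimp only; rw [hmild hs₀t ht.2 x]; abel
    have h1 : δ = Bs - ⟪e, u t x⟫ - ⟪e, wt x⟫ := by
      rw [hδ, hgHt]; simp only [hHx, inner_add_right]; ring
    have h2 : -⟪e, wt x⟫ ≤ ‖wt x‖ := by
      have := abs_real_inner_le_norm e (wt x)
      rw [hen, one_mul] at this
      linarith [neg_abs_le ⟪e, wt x⟫]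
    rw [h1]; linarith
  have hδ4 : δ ≤ 1 / 4 := by linarith
  -- (7) THE DEFICIT BOUND: either `δ ≤ t²` or `δ √(log(1/(2δ))) ≤ a √t`
  have hkey : s₀ < δ → δ * Real.sqrt (Real.log (1 / (2 * δ))) ≤ a * Real.sqrt t := by
    intro hδs
    have hδpos : 0 < δ := hs₀.trans hδs
    set ℓ : ℝ := Real.log (1 / (2 * δ)) with hℓ
    have hℓpos : 0 < ℓ := by
      rw [hℓ]; refine Real.log_pos ?_
      rw [lt_div_iff₀ (by positivity)]; linarith
    have hsqℓ : 0 < Real.sqrt ℓ := Real.sqrt_pos.2 hℓpos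
    have hℓle : ℓ ≤ 2 * Real.log (1 / t) := by
      have h1 : 1 / (2 * δ) ≤ (1 / t) ^ 2 := by
        rw [div_le_iff₀ (by positivity), one_div, inv_pow, ← hs₀_def]
        have : s₀⁻¹ * (2 * s₀) ≤ s₀⁻¹ * (2 * δ) := by gcongr
        calc (1 : ℝ) ≤ 2 := by norm_num
          _ = s₀⁻¹ * (2 * s₀) := by field_simp
          _ ≤ _ := this
      calc ℓ ≤ Real.log ((1 / t) ^ 2) := Real.log_le_log (by positivity) h1
        _ = 2 * Real.log (1 / t) := by rw [Real.log_pow]; norm_num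
    -- the Harnack factor `e^{ℓ/4} = (1/(2δ))^{1/4}` and `κ = (2δ)^{3/8}`
    set κ : ℝ := (2 * δ) ^ (3 / 8 : ℝ) with hκ
    have hκ0 : 0 ≤ κ := by rw [hκ]; positivity
    have hexpℓ : Real.exp (ℓ / 4) = (1 / (2 * δ)) ^ (1 / 4 : ℝ) := by
      rw [hℓ, Real.rpow_def_of_pos (by positivity)]; congr 1; ring
    have hκsq : 2 * (Real.exp (ℓ / 4) * δ) = κ ^ 2 := by
      have h2δ : 0 < 2 * δ := by positivity
      have hL : Real.exp (ℓ / 4) = ((2 * δ) ^ (1 / 4 : ℝ))⁻¹ := by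
        rw [hexpℓ, one_div, Real.inv_rpow h2δ.le]
      have hR : κ ^ 2 = (2 * δ) ^ (3 / 4 : ℝ) := by
        rw [hκ, ← Real.rpow_natCast, ← Real.rpow_mul h2δ.le]; norm_num
      have h34 : (2 * δ) ^ (3 / 4 : ℝ) = (2 * δ) * ((2 * δ) ^ (1 / 4 : ℝ))⁻¹ := by
        rw [← Real.rpow_neg h2δ.le, show (3 / 4 : ℝ) = 1 + -(1 / 4) by norm_num, Real.rpow_add h2δ,
          Real.rpow_one]
      rw [hL, hR, h34]; ring
    -- the one-slice bound for `σ ∈ (s₀, t)`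
    have hslice : ∀ σ ∈ Ioo s₀ t, ‖oseenSlice (1 * (t - σ)) (u σ) (u σ) x‖ ≤
        2 * CS * (t - σ) ^ (-(1 / 2 : ℝ)) *
          (κ * ((t - s₀) / (σ - s₀)) ^ (3 / 4 : ℝ) + 2 * CD * Real.sqrt t) +
          4 * CF / (Real.sqrt (t - σ) * Real.sqrt ℓ) := by
      intro σ hσ
      have hσT : σ < T := hσ.2.trans ht.2
      have htσ : 0 < t - σ := sub_pos.2 hσ.2
      have hτ : 0 < 1 * (t - σ) := by rw [one_mul]; exact htσ
      have hθ : 0 < σ - s₀ := sub_pos.2 hσ.1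
      set r : ℝ := Real.sqrt (t - σ) * Real.sqrt ℓ with hr
      have hr0 : 0 < r := by rw [hr]; exact mul_pos (Real.sqrt_pos.2 htσ) hsqℓ
      have hr2 : r ^ 2 / (4 * (t - σ)) = ℓ / 4 := by
        rw [hr, mul_pow, Real.sq_sqrt htσ.le, Real.sq_sqrt hℓpos.le]
        field_simp
      -- Harnack inside the ball
      set Λ : ℝ := ((t - s₀) / (σ - s₀)) ^ ((3 : ℝ) / 2) * Real.exp (ℓ / 4) * δ with hΛ
      have hΛ0 : 0 ≤ Λ := by rw [hΛ]; positivity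
      have hHarn : ∀ y, ‖x - y‖ < r → heatExtension (fun z => Bs - ⟪e, u s₀ z⟫) (σ - s₀) y ≤ Λ := by
        intro y hy
        have h := heatExtension_le_harnack_shift hgc hg0 hgM hσ.1 hσ.2 x y
        rw [finrank_euclideanSpace_fin] at h
        refine h.trans ?_
        rw [hΛ, ← hδ]
        refine mul_le_mul_of_nonneg_right (mul_le_mul_of_nonneg_left ?_ (by positivity)) hδ0
        refine Real.exp_le_exp.2 ?_
        rw [← hr2]
        exact div_le_div_of_nonneg_right (pow_le_pow_left₀ (norm_nonneg _) hy.le 2) (by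
          linarith [sub_pos.2 hσ.2])
      have hcontσ : Continuous (u σ) := (hcl'.contDiff_velocity ⟨hs₀.trans hσ.1, hσT.trans hTb⟩).continuous
      have huσ : ∀ y, ‖u σ y‖ ≤ 1 := fun y => hbd σ hσ.1 hσ.2.le y
      have hvW : ∀ y, u σ y = heatExtension (u s₀) (σ - s₀) y - oseenDuhamel 1 s₀ u u σ y :=
        hmild hσ.1 hσT
      have hW : ∀ y, ‖oseenDuhamel 1 s₀ u u σ y‖ ≤ 2 * CD * Real.sqrt t := hduh hσ.1 hσ.2.le
      have h := hSrc hτ hθ hBs0 hBs1 (by positivity : (0 : ℝ) ≤ 2 * CD * Real.sqrt t) hΛ0 hr0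
        hcont_s₀ hus₀ hen hcontσ huσ hvW hW hHarn
      -- simplify the right-hand side
      have hsqrtΛ : Real.sqrt (2 * Bs * Λ) ≤ κ * ((t - s₀) / (σ - s₀)) ^ (3 / 4 : ℝ) := by
        have hq : 0 ≤ (t - s₀) / (σ - s₀) := by positivity
        have h32 : ((t - s₀) / (σ - s₀)) ^ ((3 : ℝ) / 2) = (((t - s₀) / (σ - s₀)) ^ (3 / 4 : ℝ)) ^ 2 := by
          rw [← Real.rpow_natCast, ← Real.rpow_mul hq]; norm_num
        have h1 : 2 * Bs * Λ ≤ (κ * ((t - s₀) / (σ - s₀)) ^ (3 / 4 : ℝ)) ^ 2 := by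
          calc 2 * Bs * Λ ≤ 2 * 1 * Λ := by gcongr
            _ = (κ * ((t - s₀) / (σ - s₀)) ^ (3 / 4 : ℝ)) ^ 2 := by
                rw [hΛ, h32, mul_pow, ← hκsq]; ring
        calc Real.sqrt (2 * Bs * Λ) ≤ Real.sqrt ((κ * ((t - s₀) / (σ - s₀)) ^ (3 / 4 : ℝ)) ^ 2) :=
              Real.sqrt_le_sqrt h1
          _ = κ * ((t - s₀) / (σ - s₀)) ^ (3 / 4 : ℝ) :=
              Real.sqrt_sq (mul_nonneg hκ0 (Real.rpow_nonneg hq _))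
      rw [one_mul] at h
      have hτ' : 0 ≤ 2 * CS * (t - σ) ^ (-(1 / 2 : ℝ)) :=
        mul_nonneg (by positivity) (Real.rpow_nonneg (sub_pos.2 hσ.2).le _)
      calc ‖oseenSlice (1 * (t - σ)) (u σ) (u σ) x‖
          ≤ 2 * CS * (t - σ) ^ (-(1 / 2 : ℝ)) * (Real.sqrt (2 * Bs * Λ) + 2 * CD * Real.sqrt t) +
              4 * CF / r := by rw [one_mul]; exact h
        _ ≤ 2 * CS * (t - σ) ^ (-(1 / 2 : ℝ)) *
              (κ * ((t - s₀) / (σ - s₀)) ^ (3 / 4 : ℝ) + 2 * CD * Real.sqrt t) + 4 * CF / r :=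
            add_le_add (mul_le_mul_of_nonneg_left (add_le_add hsqrtΛ le_rfl) hτ') le_rfl
    -- integrate over `(s₀, t)`
    obtain ⟨hbi, hbint⟩ := fastSet_integral_sourceBound_le (s₀ := s₀) (t := t) (κ := κ) (ℓ := ℓ)
      (CS := CS) (CD := CD) (CF := CF) hs₀.le hs₀t hκ0 hℓpos hCS.le hCD.le hCF.le
    have hwt_int : ‖wt x‖ ≤ 24 * CS * κ * Real.sqrt t + 8 * CS * CD * t + 8 * CF * Real.sqrt t / Real.sqrt ℓ := by
      have hrepr : wt x = ∫ σ in Ioo s₀ t, oseenSlice (1 * (t - σ)) (u σ) (u σ) x := by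
        rw [hwt]; dsimp only; rw [oseenDuhamel_apply]; rfl
      rw [hrepr]
      refine (norm_integral_le_of_norm_le hbi ?_).trans hbint
      exact (ae_restrict_iff' measurableSet_Ioo).2 (Eventually.of_forall hslice)
    -- `κ √ℓ ≤ 2`, `t √ℓ ≤ √2 √t`
    have hκℓ : κ * Real.sqrt ℓ ≤ 2 := by
      have := fastSet_rpow_mul_sqrt_log_le (y := 2 * δ) (by positivity)
      rwa [← hκ, ← hℓ] at this
    have htℓ : t * Real.sqrt ℓ ≤ Real.sqrt 2 * Real.sqrt t := fastSet_mul_sqrt_le ht.1 hℓle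
    -- assemble: `δ √ℓ ≤ (Cov t + ‖w‖) √ℓ ≤ a √t`
    have h1 : δ * Real.sqrt ℓ ≤ (Cov * t + ‖wt x‖) * Real.sqrt ℓ :=
      mul_le_mul_of_nonneg_right hδle hsqℓ.le
    have h2 : (Cov * t + ‖wt x‖) * Real.sqrt ℓ ≤
        Cov * (t * Real.sqrt ℓ) + 24 * CS * (κ * Real.sqrt ℓ) * Real.sqrt t +
          8 * CS * CD * (t * Real.sqrt ℓ) + 8 * CF * Real.sqrt t := by
      have h3 : ‖wt x‖ * Real.sqrt ℓ ≤ (24 * CS * κ * Real.sqrt t + 8 * CS * CD * t +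
          8 * CF * Real.sqrt t / Real.sqrt ℓ) * Real.sqrt ℓ := mul_le_mul_of_nonneg_right hwt_int hsqℓ.le
      have h4 : (24 * CS * κ * Real.sqrt t + 8 * CS * CD * t + 8 * CF * Real.sqrt t / Real.sqrt ℓ) *
          Real.sqrt ℓ = 24 * CS * (κ * Real.sqrt ℓ) * Real.sqrt t + 8 * CS * CD * (t * Real.sqrt ℓ) +
          8 * CF * Real.sqrt t := by
        rw [add_mul, add_mul, div_mul_cancel₀ _ hsqℓ.ne']; ring
      have h34 := h3.trans h4.le
      calc (Cov * t + ‖wt x‖) * Real.sqrt ℓ = Cov * (t * Real.sqrt ℓ) + ‖wt x‖ * Real.sqrt ℓ := by ring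
        _ ≤ _ := by linarith [h34]
    have h5 : Cov * (t * Real.sqrt ℓ) + 24 * CS * (κ * Real.sqrt ℓ) * Real.sqrt t +
        8 * CS * CD * (t * Real.sqrt ℓ) + 8 * CF * Real.sqrt t ≤ a * Real.sqrt t := by
      have e1 : Cov * (t * Real.sqrt ℓ) ≤ Cov * (Real.sqrt 2 * Real.sqrt t) :=
        mul_le_mul_of_nonneg_left htℓ hCov
      have e2 : 24 * CS * (κ * Real.sqrt ℓ) * Real.sqrt t ≤ 24 * CS * 2 * Real.sqrt t := by
        have := mul_le_mul_of_nonneg_left hκℓ (by positivity : (0 : ℝ) ≤ 24 * CS)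
        exact mul_le_mul_of_nonneg_right this hsqt.le
      have e3 : 8 * CS * CD * (t * Real.sqrt ℓ) ≤ 8 * CS * CD * (Real.sqrt 2 * Real.sqrt t) :=
        mul_le_mul_of_nonneg_left htℓ (by positivity)
      calc _ ≤ Cov * (Real.sqrt 2 * Real.sqrt t) + 24 * CS * 2 * Real.sqrt t +
            8 * CS * CD * (Real.sqrt 2 * Real.sqrt t) + 8 * CF * Real.sqrt t :=
            add_le_add (add_le_add (add_le_add e1 e2) e3) le_rfl
        _ = a * Real.sqrt t := by rw [ha_def]; ring
    exact h1.trans (h2.trans h5)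
  -- (8) the majorant `V₀ = max δ t²` and `V₀ √(1 + log(2Bs/V₀)) ≤ a' √t`
  set V₀ : ℝ := max δ s₀ with hV₀
  have hV₀pos : 0 < V₀ := hs₀.trans_le (le_max_right _ _)
  have hδV₀ : δ ≤ V₀ := le_max_left _ _
  have hV₀M : V₀ ≤ 2 * Bs := max_le hδM (by
    rw [hs₀_def]; linarith [pow_le_one₀ ht0.le ht1 (n := 2)])
  have hlogV : Real.log (2 * Bs / V₀) ≤ Real.log 4 + Real.log (1 / (2 * V₀)) := by
    rw [← Real.log_mul (by norm_num) (by positivity)]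
    refine Real.log_le_log (by positivity) ?_
    have h4 : (4 : ℝ) * (1 / (2 * V₀)) = 2 / V₀ := by field_simp; norm_num
    rw [h4]
    exact div_le_div_of_nonneg_right (by linarith) hV₀pos.le
  have hlog4 : Real.log 4 ≤ 3 := by
    have := Real.log_le_sub_one_of_pos (by norm_num : (0 : ℝ) < 4); linarith
  have hlogV0 : 0 ≤ Real.log (2 * Bs / V₀) := Real.log_nonneg ((one_le_div hV₀pos).2 hV₀M)
  have ht_sqrt : t ≤ Real.sqrt t := by
    calc t = Real.sqrt t * Real.sqrt t := (Real.mul_self_sqrt ht.1.le).symm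
      _ ≤ 1 * Real.sqrt t := by
          refine mul_le_mul_of_nonneg_right ?_ hsqt.le
          rw [Real.sqrt_le_one]; exact ht1
      _ = Real.sqrt t := one_mul _
  have hV₀bd : V₀ * Real.sqrt (1 + Real.log (2 * Bs / V₀)) ≤ a' * Real.sqrt t := by
    rcases le_or_gt δ s₀ with hcase | hcase
    · -- `V₀ = t²`: `1 + log(2Bs/V₀) ≤ 6/t`, so `V₀ √(…) ≤ t² √6/√t ≤ 3 √t`
      have hV₀eq : V₀ = s₀ := max_eq_right hcase
      have hl1 : Real.log (1 / (2 * V₀)) ≤ 2 / t := by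
        have h1 : Real.log (1 / (2 * V₀)) ≤ Real.log ((1 / t) ^ 2) := by
          refine Real.log_le_log (by positivity) ?_
          rw [hV₀eq, hs₀_def, div_le_iff₀ (by positivity), one_div, inv_pow]
          field_simp; norm_num
        have h2 : Real.log (1 / t) ≤ 1 / t := by
          have := Real.log_le_sub_one_of_pos (by positivity : (0 : ℝ) < 1 / t); linarith
        rw [Real.log_pow] at h1
        push_cast at h1
        calc Real.log (1 / (2 * V₀)) ≤ 2 * Real.log (1 / t) := h1
          _ ≤ 2 * (1 / t) := by linarith
          _ = 2 / t := by ring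
      have h4t : (4 : ℝ) ≤ 4 / t := by
        rw [le_div_iff₀ ht0]; linarith [mul_le_of_le_one_right (by norm_num : (0 : ℝ) ≤ 4) ht1]
      have hX : 1 + Real.log (2 * Bs / V₀) ≤ 6 / t := by
        have : (6 : ℝ) / t = 4 / t + 2 / t := by ring
        linarith
      have hX' : Real.sqrt (1 + Real.log (2 * Bs / V₀)) ≤ Real.sqrt 6 / Real.sqrt t := by
        rw [← Real.sqrt_div (by norm_num : (0 : ℝ) ≤ 6)]
        exact Real.sqrt_le_sqrt hX
      have hsqrt6 : Real.sqrt 6 ≤ 3 := by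
        refine Real.sqrt_le_iff.2 ⟨by norm_num, by norm_num⟩
      calc V₀ * Real.sqrt (1 + Real.log (2 * Bs / V₀)) ≤ V₀ * (Real.sqrt 6 / Real.sqrt t) :=
            mul_le_mul_of_nonneg_left hX' hV₀pos.le
        _ = s₀ * (Real.sqrt 6 / Real.sqrt t) := by rw [hV₀eq]
        _ = t * Real.sqrt t * Real.sqrt 6 := by
            rw [hs₀_def]
            have : t ^ 2 * (Real.sqrt 6 / Real.sqrt t) = t * (t / Real.sqrt t) * Real.sqrt 6 := by ring
            rw [this, Real.div_sqrt]
        _ ≤ 1 * Real.sqrt t * 3 := by gcongr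
        _ = 3 * Real.sqrt t := by ring
        _ ≤ a' * Real.sqrt t := by
            refine mul_le_mul_of_nonneg_right ?_ hsqt.le
            rw [ha'_def]; linarith [mul_nonneg (by norm_num : (0:ℝ) ≤ 4) hCD.le]
    · -- `V₀ = δ > t²`: `δ √(1 + log(2Bs/δ)) ≤ δ (2 + √ℓ) ≤ 2δ + a √t`
      have hV₀eq : V₀ = δ := max_eq_left hcase.le
      have hk := hkey hcase
      have hδpos : 0 < δ := hs₀.trans hcase
      rw [hV₀eq] at hlogV hlogV0 ⊢
      have hℓ0 : 0 ≤ Real.log (1 / (2 * δ)) := by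
        refine Real.log_nonneg ?_
        rw [le_div_iff₀ (by positivity : (0 : ℝ) < 2 * δ)]; linarith
      have hX : 1 + Real.log (2 * Bs / δ) ≤ 4 + Real.log (1 / (2 * δ)) := by linarith
      have hsq : Real.sqrt (1 + Real.log (2 * Bs / δ)) ≤ 2 + Real.sqrt (Real.log (1 / (2 * δ))) := by
        calc Real.sqrt (1 + Real.log (2 * Bs / δ)) ≤ Real.sqrt (4 + Real.log (1 / (2 * δ))) :=
              Real.sqrt_le_sqrt hX
          _ ≤ 2 + Real.sqrt (Real.log (1 / (2 * δ))) := by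
              refine Real.sqrt_le_iff.2 ⟨by positivity, ?_⟩
              rw [add_sq, Real.sq_sqrt hℓ0]
              linarith [Real.sqrt_nonneg (Real.log (1 / (2 * δ)))]
      have h2δ : 2 * δ ≤ (2 * Cov + 4 * CD) * Real.sqrt t := by
        have e1 : Cov * t ≤ Cov * Real.sqrt t := mul_le_mul_of_nonneg_left ht_sqrt hCov
        have e2 : (2 * Cov + 4 * CD) * Real.sqrt t = 2 * (Cov * Real.sqrt t) + 2 * (2 * CD * Real.sqrt t) := by
          ring
        rw [e2]; linarith [hδle, hwt_le, e1]
      calc δ * Real.sqrt (1 + Real.log (2 * Bs / δ)) ≤ δ * (2 + Real.sqrt (Real.log (1 / (2 * δ)))) :=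
            mul_le_mul_of_nonneg_left hsq hδ0
        _ = 2 * δ + δ * Real.sqrt (Real.log (1 / (2 * δ))) := by ring
        _ ≤ (2 * Cov + 4 * CD) * Real.sqrt t + a * Real.sqrt t := add_le_add h2δ hk
        _ = (2 * Cov + 4 * CD + a) * Real.sqrt t := by ring
        _ ≤ a' * Real.sqrt t := mul_le_mul_of_nonneg_right (by rw [ha'_def]; linarith) hsqt.le
  exact ⟨V₀, hδV₀, hV₀pos, hV₀M, by rw [← ha'eq]; exact hV₀bd⟩

end Summit.NavierStokesRegularity.NavierStokesRegularity.Theorems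

end
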